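import Literature.NumberTheory.LFunctions.WeilExplicit
import Mathlib
import HarnessLib

/-!
# THETA kernel certificate, analytic layer D4: the ONE-ATOM decomposition `k(L) + k(−L) = −2e^{L/2}·I + r` (RH-FREE)

Cell `rh-explicit`, WEIL column, seat handoff-prove-2 gen12 (THETA-ASSIGN v1.0/1.1 §3 D4, abstract form; THETA-CERT-cc6 §D4).
Upper clauses of truncated Weil forms only; nothing here bears on the truth of RH.

ABSTRACT SETTING.  `g : ℝ → ℂ` continuous, REAL-valued, vanishing off `[−a, a]`; `0 < δ`; `L := 2a − 2δ` (`= log q` for the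
witness, `a = (log q)/2 + δ`).  With `gOdd(u) = g(u) − g(−u)` and `k = gOdd ⋆ g̃Odd` (`weilConv gOdd (weilReflect gOdd)`):

* `weilConv_odd_eq` : `k(t) = 2C(t) − V(t) − V(−t)`, `C(t) = ∫ g(u)g(u−t)du`, `V(t) = ∫ g(u)g(t−u)du` (THETA-CERT §D4);
* TOP LAYER EXACT (`integral_top_eq`): if `g(a − w) = e^{(a−w)/2}·ρ(w)` for `w ∈ [0, 2δ]` then `V(L) = e^{L/2}·∫₀^{2δ} ρ(w)ρ(2δ−w)dw`;
* BOTTOM LAYER (`norm_C_le`, `norm_Vneg_le`): if `‖g‖ ≤ S_top` on `[a−2δ, a]` and `‖g‖ ≤ S_bot` on `[−a, −a+2δ]` then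
  `‖C(L)‖ ≤ 2δ·S_top·S_bot` and `‖V(−L)‖ ≤ 2δ·S_bot²`;
* ASSEMBLY (`norm_atom_sub_le`): **`‖k(L) + k(−L) + 2e^{L/2}·∫₀^{2δ} ρ(w)ρ(2δ−w)dw‖ ≤ 8δ·S_top·S_bot + 4δ·S_bot²`** (= `2·r̄`).
For the witness (`g = P.g`, `ρ = Rtop ∘ τ₁` by W2's top-layer form, `S_top = e^{a/2}h_max`, `S_bot = e^{(2δ−a)/2}M_Lχ_L`) this is
`k(log q) + k(−log q) = −2√q·P.Itop + r`, `‖r‖ ≤ 2·P.rbar` — the `atom` let of the checker.  No measurability beyond continuity is used.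
-/

noncomputable section

set_option linter.dupNamespace false

open Complex Set MeasureTheory Filter
open scoped Real Topology ComplexConjugate

namespace Summit.RiemannHypothesis.RiemannHypothesis.Theorems.WeilColumn.ThetaAtom

open Literature.NumberTheory.LFunctions

variable {g : ℝ → ℂ} {a δ : ℝ}

/-! ## §1 Integrability of the products and the odd expansion `k = 2C − V(t) − V(−t)` -/

/-- A continuous function vanishing off `[−a, a]` has compact support. -/
theorem hasCompactSupport_of_vanish (hgl : ∀ x, x < -a → g x = 0) (hgr : ∀ x, a < x → g x = 0) :
    HasCompactSupport g := by
  refine HasCompactSupport.of_support_subset_isCompact (isCompact_Icc (a := -a) (b := a)) fun x hx ↦ ?_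
  rw [Function.mem_support] at hx
  by_contra h
  rw [mem_Icc, not_and_or, not_le, not_le] at h
  rcases h with h | h
  · exact hx (hgl x h)
  · exact hx (hgr x h)

/-- Products `u ↦ g(u)·g(φ(u))` with `φ` continuous are integrable (`g` continuous of compact support). -/
theorem integrable_mul_comp (hgc : Continuous g) (hgl : ∀ x, x < -a → g x = 0) (hgr : ∀ x, a < x → g x = 0)
    {φ : ℝ → ℝ} (hφ : Continuous φ) : Integrable fun u ↦ g u * g (φ u) := by
  have hcs := hasCompactSupport_of_vanish hgl hgr
  exact ((hgc.mul (hgc.comp hφ)).integrable_of_hasCompactSupport (hcs.mul_right))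

/-- **`k(t) = 2C(t) − V(t) − V(−t)`** for the odd extension of a continuous, real-valued, compactly supported `g`. [THETA-CERT-cc6 §D4] -/
theorem weilConv_odd_eq (hgc : Continuous g) (hreal : ∀ x, conj (g x) = g x) (hgl : ∀ x, x < -a → g x = 0)
    (hgr : ∀ x, a < x → g x = 0) (t : ℝ) :
    weilConv (fun u ↦ g u - g (-u)) (weilReflect fun u ↦ g u - g (-u)) t =
      2 * (∫ u, g u * g (u - t)) - (∫ u, g u * g (t - u)) - ∫ u, g u * g (-t - u) := by
  rw [weilConv_apply]
  have hpt : ∀ u : ℝ, (g u - g (-u)) * weilReflect (fun u ↦ g u - g (-u)) (t - u) =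
      g u * g (u - t) - g u * g (t - u) - g (-u) * g (u - t) + g (-u) * g (t - u) := by
    intro u
    simp only [weilReflect, map_sub, hreal, neg_sub]
    ring
  simp_rw [hpt]
  have i1 := integrable_mul_comp hgc hgl hgr (φ := fun u ↦ u - t) (by fun_prop)
  have i2 := integrable_mul_comp hgc hgl hgr (φ := fun u ↦ t - u) (by fun_prop)
  have hgn : Continuous fun u : ℝ ↦ g (-u) := hgc.comp continuous_neg
  have hcs := hasCompactSupport_of_vanish hgl hgr
  have hcsn : HasCompactSupport fun u : ℝ ↦ g (-u) := hcs.comp_homeomorph (Homeomorph.neg ℝ)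
  have i3 : Integrable fun u ↦ g (-u) * g (u - t) :=
    (hgn.mul (hgc.comp (by fun_prop))).integrable_of_hasCompactSupport hcsn.mul_right
  have i4 : Integrable fun u ↦ g (-u) * g (t - u) :=
    (hgn.mul (hgc.comp (by fun_prop))).integrable_of_hasCompactSupport hcsn.mul_right
  have i12 : Integrable fun u ↦ g u * g (u - t) - g u * g (t - u) := i1.sub i2
  have i123 : Integrable fun u ↦ g u * g (u - t) - g u * g (t - u) - g (-u) * g (u - t) := i12.sub i3
  rw [integral_add i123 i4, integral_sub i12 i3, integral_sub i1 i2]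
  -- the two reflected integrals
  have e3 : ∫ u, g (-u) * g (u - t) = ∫ u, g u * g (-t - u) := by
    rw [← integral_neg_eq_self (fun u ↦ g (-u) * g (u - t)) volume]
    refine integral_congr_ae (Eventually.of_forall fun u ↦ ?_)
    simp only [neg_neg]
    rw [show -u - t = -t - u by ring]
  have e4 : ∫ u, g (-u) * g (t - u) = ∫ u, g u * g (u - t) := by
    rw [← integral_neg_eq_self (fun u ↦ g (-u) * g (t - u)) volume]
    have : (fun u : ℝ ↦ g (- -u) * g (t - -u)) = fun u ↦ (fun w ↦ g (w - t) * g w) (u + t) := by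
      funext u; simp only [neg_neg, sub_neg_eq_add]; ring_nf
    rw [this, integral_add_right_eq_self (fun w ↦ g (w - t) * g w) t]
    exact integral_congr_ae (Eventually.of_forall fun u ↦ by ring)
  rw [e3, e4]
  ring

/-! ## §2 The layers at `t = L = 2a − 2δ` -/

/-- **TOP LAYER, EXACT**: if `g(a − w) = e^{(a−w)/2}ρ(w)` for `w ∈ [0, 2δ]` (and `g = 0` beyond `a`, `0 < δ`), then
`V(L) = ∫ g(u)g(L−u)du = e^{L/2}·∫₀^{2δ} ρ(w)ρ(2δ−w)dw`, `L = 2a − 2δ`. [THETA-CERT-cc6 §D4] -/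
theorem integral_top_eq (hδ : 0 < δ) (hgr : ∀ x, a < x → g x = 0)
    {ρ : ℝ → ℝ} (htop : ∀ w ∈ Icc (0 : ℝ) (2 * δ), g (a - w) = ((Real.exp ((a - w) / 2) * ρ w : ℝ) : ℂ)) :
    ∫ u, g u * g (2 * a - 2 * δ - u) =
      ((Real.exp ((2 * a - 2 * δ) / 2) * ∫ w in (0 : ℝ)..(2 * δ), ρ w * ρ (2 * δ - w) : ℝ) : ℂ) := by
  set L := 2 * a - 2 * δ with hL
  -- the integrand vanishes off `[a − 2δ, a]`
  have hvan' : ∀ u, u ∉ Icc (a - 2 * δ) a → g u * g (L - u) = 0 := by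
    intro u hu
    rw [mem_Icc, not_and_or, not_le, not_le] at hu
    rcases hu with hu | hu
    · have : a < L - u := by rw [hL]; linarith
      rw [hgr (L - u) this, mul_zero]
    · rw [hgr u hu, zero_mul]
  have heq : (fun u ↦ g u * g (L - u)) = (Icc (a - 2 * δ) a).indicator fun u ↦ g u * g (L - u) := by
    funext u
    by_cases hu : u ∈ Icc (a - 2 * δ) a
    · rw [indicator_of_mem hu]
    · rw [indicator_of_notMem hu, hvan' u hu]
  rw [heq, integral_indicator measurableSet_Icc, integral_Icc_eq_integral_Ioc,
    ← intervalIntegral.integral_of_le (by linarith)]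
  -- substitute `u = a − w`
  have hsub := intervalIntegral.integral_comp_sub_left (fun u ↦ g u * g (L - u)) a (a := 0) (b := 2 * δ)
  -- `∫_{0}^{2δ} f(a − w) dw = ∫_{a−2δ}^{a} f(u) du`
  rw [sub_zero] at hsub
  rw [← hsub]
  have hpt : ∀ w ∈ uIcc (0 : ℝ) (2 * δ), g (a - w) * g (L - (a - w)) = ((Real.exp (L / 2) * (ρ w * ρ (2 * δ - w)) : ℝ) : ℂ) := by
    intro w hw
    rw [uIcc_of_le (by linarith)] at hw
    have hw' : 2 * δ - w ∈ Icc (0 : ℝ) (2 * δ) := ⟨by linarith [hw.2], by linarith [hw.1]⟩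
    rw [show L - (a - w) = a - (2 * δ - w) by rw [hL]; ring, htop w hw, htop (2 * δ - w) hw', ← Complex.ofReal_mul]
    have e : Real.exp ((a - w) / 2) * Real.exp ((a - (2 * δ - w)) / 2) = Real.exp (L / 2) := by
      rw [← Real.exp_add]; congr 1; rw [hL]; ring
    congr 1
    rw [← e]; ring
  rw [intervalIntegral.integral_congr hpt, intervalIntegral.integral_ofReal, intervalIntegral.integral_const_mul]

/-- **BOTTOM LAYER, the cross overlap**: `‖C(L)‖ = ‖∫ g(u)g(u − L)du‖ ≤ 2δ·S_top·S_bot` (`u` in the top layer, `u − L` in the bottom layer).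
[THETA-CERT-cc6 §D4] -/
theorem norm_C_le (hδ : 0 < δ) (hgl : ∀ x, x < -a → g x = 0) (hgr : ∀ x, a < x → g x = 0)
    {Stop Sbot : ℝ} (hS : 0 ≤ Stop) (hStop : ∀ x ∈ Icc (a - 2 * δ) a, ‖g x‖ ≤ Stop)
    (hSbot : ∀ x ∈ Icc (-a) (-a + 2 * δ), ‖g x‖ ≤ Sbot) :
    ‖∫ u, g u * g (u - (2 * a - 2 * δ))‖ ≤ 2 * δ * Stop * Sbot := by
  set L := 2 * a - 2 * δ with hL
  have hbound : ∀ᵐ u : ℝ, ‖g u * g (u - L)‖ ≤ (Icc (a - 2 * δ) a).indicator (fun _ ↦ Stop * Sbot) u := by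
    refine Eventually.of_forall fun u ↦ ?_
    by_cases hu : u ∈ Icc (a - 2 * δ) a
    · rw [indicator_of_mem hu, norm_mul]
      have h2 : u - L ∈ Icc (-a) (-a + 2 * δ) := ⟨by rw [hL]; linarith [hu.1], by rw [hL]; linarith [hu.2]⟩
      exact mul_le_mul (hStop u hu) (hSbot _ h2) (norm_nonneg _) hS
    · rw [indicator_of_notMem hu]
      rw [mem_Icc, not_and_or, not_le, not_le] at hu
      rcases hu with hu | hu
      · rw [hgl (u - L) (by rw [hL]; linarith), mul_zero, norm_zero]
      · rw [hgr u hu, zero_mul, norm_zero]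
  have hint : Integrable ((Icc (a - 2 * δ) a).indicator fun _ : ℝ ↦ Stop * Sbot) :=
    (integrable_indicator_iff measurableSet_Icc).2 continuous_const.integrableOn_Icc
  refine (norm_integral_le_of_norm_le hint hbound).trans (le_of_eq ?_)
  rw [integral_indicator_const _ measurableSet_Icc, Real.volume_real_Icc_of_le (by linarith), smul_eq_mul]
  ring

/-- **BOTTOM LAYER, the reflected overlap**: `‖V(−L)‖ = ‖∫ g(u)g(−L − u)du‖ ≤ 2δ·S_bot²` (both arguments in the bottom layer).
[THETA-CERT-cc6 §D4] -/
theorem norm_Vneg_le (hδ : 0 < δ) (hgl : ∀ x, x < -a → g x = 0)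
    {Sbot : ℝ} (hS : 0 ≤ Sbot) (hSbot : ∀ x ∈ Icc (-a) (-a + 2 * δ), ‖g x‖ ≤ Sbot) :
    ‖∫ u, g u * g (-(2 * a - 2 * δ) - u)‖ ≤ 2 * δ * Sbot ^ 2 := by
  set L := 2 * a - 2 * δ with hL
  have hbound : ∀ᵐ u : ℝ, ‖g u * g (-L - u)‖ ≤ (Icc (-a) (-a + 2 * δ)).indicator (fun _ ↦ Sbot * Sbot) u := by
    refine Eventually.of_forall fun u ↦ ?_
    by_cases hu : u ∈ Icc (-a) (-a + 2 * δ)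
    · rw [indicator_of_mem hu, norm_mul]
      have h2 : -L - u ∈ Icc (-a) (-a + 2 * δ) := ⟨by rw [hL]; linarith [hu.2], by rw [hL]; linarith [hu.1]⟩
      exact mul_le_mul (hSbot u hu) (hSbot _ h2) (norm_nonneg _) hS
    · rw [indicator_of_notMem hu]
      rw [mem_Icc, not_and_or, not_le, not_le] at hu
      rcases hu with hu | hu
      · rw [hgl u hu, zero_mul, norm_zero]
      · rw [hgl (-L - u) (by rw [hL]; linarith), mul_zero, norm_zero]
  have hint : Integrable ((Icc (-a) (-a + 2 * δ)).indicator fun _ : ℝ ↦ Sbot * Sbot) :=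
    (integrable_indicator_iff measurableSet_Icc).2 continuous_const.integrableOn_Icc
  refine (norm_integral_le_of_norm_le hint hbound).trans (le_of_eq ?_)
  rw [integral_indicator_const _ measurableSet_Icc, Real.volume_real_Icc_of_le (by linarith), smul_eq_mul]
  ring

/-! ## §3 Assembly: the one-atom decomposition -/

/-- **THE ONE-ATOM DECOMPOSITION**: for `g` continuous, real-valued, vanishing off `[−a, a]`, with the top-layer form
`g(a−w) = e^{(a−w)/2}ρ(w)` (`w ∈ [0,2δ]`) and the layer bounds `‖g‖ ≤ S_top` on `[a−2δ, a]`, `‖g‖ ≤ S_bot` on `[−a, −a+2δ]`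
(`0 < δ`), the autocorrelation `k` of `gOdd = g − g(−·)` satisfies, at `L = 2a − 2δ`,
`‖k(L) + k(−L) + 2e^{L/2}·∫₀^{2δ}ρ(w)ρ(2δ−w)dw‖ ≤ 8δ·S_top·S_bot + 4δ·S_bot²`. [THETA-CERT-cc6 §D4] -/
theorem norm_atom_sub_le (hδ : 0 < δ) (hgc : Continuous g) (hreal : ∀ x, conj (g x) = g x)
    (hgl : ∀ x, x < -a → g x = 0) (hgr : ∀ x, a < x → g x = 0)
    {ρ : ℝ → ℝ} (htop : ∀ w ∈ Icc (0 : ℝ) (2 * δ), g (a - w) = ((Real.exp ((a - w) / 2) * ρ w : ℝ) : ℂ))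
    {Stop Sbot : ℝ} (hS1 : 0 ≤ Stop) (hS2 : 0 ≤ Sbot) (hStop : ∀ x ∈ Icc (a - 2 * δ) a, ‖g x‖ ≤ Stop)
    (hSbot : ∀ x ∈ Icc (-a) (-a + 2 * δ), ‖g x‖ ≤ Sbot) :
    ‖weilConv (fun u ↦ g u - g (-u)) (weilReflect fun u ↦ g u - g (-u)) (2 * a - 2 * δ) +
        weilConv (fun u ↦ g u - g (-u)) (weilReflect fun u ↦ g u - g (-u)) (-(2 * a - 2 * δ)) +
        2 * ((Real.exp ((2 * a - 2 * δ) / 2) * ∫ w in (0 : ℝ)..(2 * δ), ρ w * ρ (2 * δ - w) : ℝ) : ℂ)‖ ≤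
      8 * δ * Stop * Sbot + 4 * δ * Sbot ^ 2 := by
  set L := 2 * a - 2 * δ with hL
  rw [weilConv_odd_eq hgc hreal hgl hgr L, weilConv_odd_eq hgc hreal hgl hgr (-L), neg_neg]
  have hV : ∫ u, g u * g (L - u) = ((Real.exp (L / 2) * ∫ w in (0 : ℝ)..(2 * δ), ρ w * ρ (2 * δ - w) : ℝ) : ℂ) :=
    integral_top_eq hδ hgr htop
  have hC := norm_C_le hδ hgl hgr hS1 hStop hSbot
  have hVn := norm_Vneg_le hδ hgl hS2 hSbot
  -- `C(−L) = C(L)` (translate by `L`)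
  have hCC : ∫ u, g u * g (u - -L) = ∫ u, g u * g (u - L) := by
    have : (fun u : ℝ ↦ g u * g (u - -L)) = fun u ↦ (fun w ↦ g (w - L) * g w) (u + L) := by
      funext u
      show g u * g (u - -L) = g (u + L - L) * g (u + L)
      rw [add_sub_cancel_right, sub_neg_eq_add, mul_comm]
    rw [this, integral_add_right_eq_self (fun w ↦ g (w - L) * g w) L]
    exact integral_congr_ae (Eventually.of_forall fun u ↦ by ring)
  rw [hCC, hV]
  -- the expression is `4C(L) − 2V(−L)` plus cancelling exact terms
  have e : 2 * (∫ u, g u * g (u - L)) - ((Real.exp (L / 2) * ∫ w in (0 : ℝ)..(2 * δ), ρ w * ρ (2 * δ - w) : ℝ) : ℂ) -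
      (∫ u, g u * g (-L - u)) +
      (2 * (∫ u, g u * g (u - L)) - (∫ u, g u * g (-L - u)) -
        ((Real.exp (L / 2) * ∫ w in (0 : ℝ)..(2 * δ), ρ w * ρ (2 * δ - w) : ℝ) : ℂ)) +
      2 * ((Real.exp (L / 2) * ∫ w in (0 : ℝ)..(2 * δ), ρ w * ρ (2 * δ - w) : ℝ) : ℂ) =
      4 * (∫ u, g u * g (u - L)) - 2 * ∫ u, g u * g (-L - u) := by ring
  rw [e]
  calc ‖4 * (∫ u, g u * g (u - L)) - 2 * ∫ u, g u * g (-L - u)‖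
      ≤ ‖4 * ∫ u, g u * g (u - L)‖ + ‖2 * ∫ u, g u * g (-L - u)‖ := norm_sub_le _ _
    _ = 4 * ‖∫ u, g u * g (u - L)‖ + 2 * ‖∫ u, g u * g (-L - u)‖ := by
        rw [norm_mul, norm_mul]; norm_num
    _ ≤ 4 * (2 * δ * Stop * Sbot) + 2 * (2 * δ * Sbot ^ 2) := by gcongr
    _ = 8 * δ * Stop * Sbot + 4 * δ * Sbot ^ 2 := by ring

end Summit.RiemannHypothesis.RiemannHypothesis.Theorems.WeilColumn.ThetaAtom

end
-- 2026-08-26T07:25Z: byte-identical re-land to refresh the stranded hub olean (ops-buildfix recipe); no content change.
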